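import Literature.Analysis.FluidPDE.KatoSymmetryCovariance
import Literature.Analysis.FluidPDE.SuitableWeak
import HarnessLib

/-!
# Local-in-time Kato solutions under scalings and translations; singular parabolic cylinders

Analysis/FluidPDE support file, definitions-free (serves the named facts around
`Literature.Analysis.FluidPDE.rusin_sverak_minimal_data_compact`, `RusinSverakCompactness.lean`, which transcribe
Rusin–Šverák, J. Funct. Anal. 260 (2011) = arXiv:0911.0500, Cor. 4.3).

In the proof of Cor. 4.3 (arXiv p. 8) Rusin–Šverák normalise a sequence of blow-up data:
"Find `λ_k > 0` and `x₀^k` so that the functions given by `v^k(x) = λ_k u₀^k(λ_k x - x₀^k)`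
develop their first singularity at time `t = 1` and that `(x,t) = (0,1)` is a singular point of
`v^k`." This uses, tacitly, that the symmetries `u(t,x) ↦ λ u(λ² t, λ x - x₀)` of the
Navier–Stokes equations (§1 p. 3) transport local-in-time solutions together with their singular
points. The global-in-time (`T_max = ∞`) covariance is `KatoSymmetryCovariance.lean`; this file
**proves** the local-in-time version for the tree's notions:

* `Fluid.aestronglyMeasurable_comp_stAffine_Ioo`: space–time measurability on strips
  `(0, T) × E` is transported by `(s, y) ↦ (β s, x₀ + γ y)` to `(0, T/β) × E`;
* `Fluid.eLpNorm_top_comp_stAffine_restrict_preimage`: the essential supremum over `Φ⁻¹(S)` of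
  `G ∘ Φ` is the essential supremum of `G` over `S` for the space–time affine bijections
  `Φ = Fluid.stAffine β γ t₀ x₀` (they map Lebesgue measure to a multiple of itself,
  `Fluid.map_stAffine_volume_restrict_preimage`);
* `Fluid.stAffine_preimage_parabolicCylinder`: parabolic dilations map backward parabolic
  cylinders `Q_r(t, x)` (`Fluid.parabolicCylinder`, CKN 1982 §2) to backward parabolic cylinders;
* `NS.eLpNorm_top_uncurry_rescale_translate`: hence
  `ess sup_{Q_r(t₀, y)} |λ u(λ² ·, λ · - x₀)| = λ · ess sup_{Q_{λ r}(λ² t₀, λ y - x₀)} |u|`, so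
  essential unboundedness on all backward cylinders at a space–time point ("a singular point",
  in the `L^∞` form of CKN 1982 §6 used by `Fluid.IsRegularPoint`) is transported to the image
  point;
* `NS.kato_local_rescale_translate`: if `u` is a mild solution on `[0, T)` in Kato's class
  `C([0,T); L³(ℝ³))` with datum `u₀` (duality form `Fluid.IsMildNSSolutionOn (Ico 0 T)`,
  measurable on `(0,T) × ℝ³`), then `(t, x) ↦ λ u(λ² t, λ x - x₀)` is one on `[0, T/λ²)` with
  datum `λ u₀(λ · - x₀)` (`NS.rescaleData λ (u₀ (· - x₀))`);
* `NS.kato_local_normalise`: with `λ = √T` and `x₀ = -x_*` a Kato solution on `[0, T)` that is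
  singular at `(T, x_*)` becomes a Kato solution on `[0, 1)` singular at `(1, 0)` — exactly the
  normalisation of the printed proof.

## Mathlib / tree search

Tree: `Fluid.IsMildNSSolutionBetween.nsRescale_zero` (`SelfSimilarProofs.lean`),
`Fluid.IsMildNSSolutionBetween.comp_sub_right_zero`, `NS.continuousInLpOn_three_rescale`,
`Fluid.ContinuousInLpOn.comp_sub_right`, `Fluid.aestronglyMeasurable_comp_stAffine_Ioi`
(`KatoSymmetryCovariance.lean`), `Fluid.stAffine_preimage_cylinder`,
`Fluid.map_stAffine_volume_restrict_preimage`, `Fluid.measurableEmbedding_stAffine`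
(`SpaceTimeRescaling.lean`), `Fluid.parabolicCylinder` (`SuitableWeak.lean`). Mathlib:
`MeasurableEmbedding.eLpNorm_map_measure`, `eLpNormEssSup_smul_measure`, `eLpNorm_const_smul`.

## References

* W. Rusin, V. Šverák, *Minimal initial data for potential Navier–Stokes singularities*,
  J. Funct. Anal. 260 (2011) 879–891 = arXiv:0911.0500, §1 (p. 3), proof of Cor. 4.3 (p. 8).
* L. Caffarelli, R. Kohn, L. Nirenberg, CPAM 35 (1982), §2 (parabolic cylinders), §6
  (regular points: `u ∈ L^∞` near the point).
* T. Kato, Math. Z. 187 (1984), 471–480, §1 (scale invariance of `L³(ℝ³)`).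
-/

noncomputable section

open MeasureTheory TopologicalSpace Set Function Filter Topology Module
open scoped ENNReal NNReal

namespace Literature.Analysis.FluidPDE

section Fluid

section Affine

variable {E : Type*} [NormedAddCommGroup E] [InnerProductSpace ℝ E] [FiniteDimensional ℝ E]
  [MeasurableSpace E] [BorelSpace E]
variable {F : Type*} [NormedAddCommGroup F]

omit [FiniteDimensional ℝ E] [MeasurableSpace E] [BorelSpace E] in
/-- The affine map `(s, y) ↦ (β s, x₀ + γ y)` (`β > 0`) pulls the strip `(0, T) × E` back to the
strip `(0, T/β) × E`. [folklore] -/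
theorem stAffine_preimage_Ioo_prod_univ {β : ℝ} (hβ : 0 < β) (γ : ℝ) (x₀ : E) (T : ℝ) :
    stAffine β γ 0 x₀ ⁻¹' (Ioo (0 : ℝ) T ×ˢ (univ : Set E)) = Ioo 0 (T / β) ×ˢ univ := by
  ext ⟨s, y⟩
  simp only [mem_preimage, stAffine_apply, zero_add, mem_prod, mem_Ioo, mem_univ, and_true]
  rw [lt_div_iff₀ hβ, mul_comm s β]
  constructor
  · rintro ⟨h1, h2⟩
    exact ⟨pos_of_mul_pos_right h1 hβ.le, h2⟩
  · rintro ⟨h1, h2⟩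
    exact ⟨mul_pos hβ h1, h2⟩

/-- Space–time measurability on the strip `(0, T) × E` is transported by the affine maps
`(s, y) ↦ (β s, x₀ + γ y)` (`β, γ > 0`) to the strip `(0, T/β) × E`: these maps are
quasi-measure-preserving bijections between the strips
(`Fluid.map_stAffine_volume_restrict_preimage`). [folklore] -/
theorem aestronglyMeasurable_comp_stAffine_Ioo {β γ : ℝ} (hβ : 0 < β) (hγ : 0 < γ) (x₀ : E)
    {T : ℝ} {G : ℝ × E → F}
    (hG : AEStronglyMeasurable G (volume.restrict (Ioo (0 : ℝ) T ×ˢ (univ : Set E)))) :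
    AEStronglyMeasurable (G ∘ stAffine β γ 0 x₀)
      (volume.restrict (Ioo (0 : ℝ) (T / β) ×ˢ (univ : Set E))) := by
  have hq : Measure.QuasiMeasurePreserving (stAffine β γ 0 x₀)
      (volume.restrict (Ioo (0 : ℝ) (T / β) ×ˢ (univ : Set E)))
      (volume.restrict (Ioo (0 : ℝ) T ×ˢ (univ : Set E))) := by
    refine ⟨measurable_stAffine _ _ _ _, ?_⟩
    have hmap := map_stAffine_volume_restrict_preimage hβ hγ 0 x₀ (Ioo (0 : ℝ) T ×ˢ (univ : Set E))
    rw [stAffine_preimage_Ioo_prod_univ hβ] at hmap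
    rw [hmap]
    exact Measure.smul_absolutelyContinuous
  exact hG.comp_quasiMeasurePreserving hq

/-- **Essential suprema are invariant under the space–time affine bijections**: for
`Φ = stAffine β γ t₀ x₀` (`β, γ > 0`) and any set `S`,
`ess sup_{Φ⁻¹(S)} ‖G ∘ Φ‖ = ess sup_S ‖G‖` (`Φ` maps Lebesgue measure restricted to `Φ⁻¹(S)` to
the positive multiple `(β γⁿ)⁻¹` of Lebesgue measure restricted to `S`, and essential suprema
only see null sets). [folklore] -/
theorem eLpNorm_top_comp_stAffine_restrict_preimage {β γ : ℝ} (hβ : 0 < β) (hγ : 0 < γ)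
    (t₀ : ℝ) (x₀ : E) (G : ℝ × E → F) (S : Set (ℝ × E)) :
    eLpNorm (G ∘ stAffine β γ t₀ x₀) ∞ (volume.restrict (stAffine β γ t₀ x₀ ⁻¹' S)) =
      eLpNorm G ∞ (volume.restrict S) := by
  rw [← (measurableEmbedding_stAffine hβ.ne' hγ.ne' t₀ x₀).eLpNorm_map_measure,
    map_stAffine_volume_restrict_preimage hβ hγ, eLpNorm_exponent_top, eLpNorm_exponent_top]
  have hk : ENNReal.ofReal (β * γ ^ finrank ℝ E)⁻¹ ≠ 0 :=
    (ENNReal.ofReal_pos.2 (by positivity)).ne'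
  refine le_antisymm (eLpNormEssSup_mono_measure _ Measure.smul_absolutelyContinuous)
    (eLpNormEssSup_mono_measure _ fun s hs => ?_)
  simp only [Measure.smul_apply, smul_eq_mul, mul_eq_zero] at hs
  exact hs.resolve_left hk

omit [FiniteDimensional ℝ E] [MeasurableSpace E] [BorelSpace E] in
/-- **Parabolic dilations map backward parabolic cylinders to backward parabolic cylinders**:
with `Φ(s, y) = (γ² s, x₀ + γ y)` (`γ > 0`),
`Φ⁻¹(Q_{γ r}(γ² t₀, x₀ + γ y)) = Q_r(t₀, y)` (CKN 1982, §2: `Q_r(x,t) = B_r(x) × (t - r², t)` is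
adapted to the scaling `(x, t) ↦ (λ x, λ² t)`). [cite: CaffarelliKohnNirenberg1982, §2 (parabolic cylinders and scaling)] -/
theorem KatoLocalCovariance.stAffine_preimage_parabolicCylinder {γ : ℝ} (hγ : 0 < γ) (x₀ : E) (r t₀ : ℝ) (y : E) :
    stAffine (γ ^ 2) γ 0 x₀ ⁻¹' parabolicCylinder (γ * r) ((γ ^ 2 * t₀ : ℝ), x₀ + γ • y) =
      parabolicCylinder r ((t₀ : ℝ), y) := by
  have hγ2 : 0 < γ ^ 2 := pow_pos hγ 2
  simp only [parabolicCylinder]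
  rw [stAffine_preimage_cylinder hγ2 hγ]
  have e1 : (γ ^ 2 * t₀ - (γ * r) ^ 2 - 0) / γ ^ 2 = t₀ - r ^ 2 := by
    field_simp
    ring
  have e2 : (γ ^ 2 * t₀ - 0) / γ ^ 2 = t₀ := by
    rw [sub_zero, mul_div_cancel_left₀ _ hγ2.ne']
  have e3 : γ⁻¹ • (x₀ + γ • y - x₀) = y := by
    rw [add_sub_cancel_left, smul_smul, inv_mul_cancel₀ hγ.ne', one_smul]
  have e4 : γ * r / γ = r := by
    field_simp
  rw [e1, e2, e3, e4]

end Affine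

end Fluid

section NS

/-! ### Singular backward cylinders under the Rusin–Šverák symmetries -/

/-- **Transport of essential suprema over backward parabolic cylinders** under
`u ↦ λ u(λ² ·, λ · - x₀)` (`λ > 0`):
`ess sup_{Q_r(t₀, y)} |λ u(λ² t, λ x - x₀)| = λ · ess sup_{Q_{λ r}(λ² t₀, λ y - x₀)} |u|`.
In particular essential unboundedness of `u` on every backward cylinder at `(T, x_*)` is
equivalent to that of the transformed field at `(T/λ², (x_* + x₀)/λ)` (Rusin–Šverák 2011, proof
of Cor. 4.3, p. 8: the symmetries move the singular point to `(0, 1)`).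
[cite: RusinSverak2011, proof of Cor. 4.3 (arXiv:0911.0500 p. 8) with §1 (p. 3)] -/
theorem eLpNorm_top_uncurry_rescale_translate
    (u : ℝ → EuclideanSpace ℝ (Fin 3) → EuclideanSpace ℝ (Fin 3)) {c : ℝ} (hc : 0 < c)
    (x₀ : EuclideanSpace ℝ (Fin 3)) (r t₀ : ℝ) (y : EuclideanSpace ℝ (Fin 3)) :
    eLpNorm (uncurry fun t x => c • u (c ^ 2 * t) (c • x - x₀)) ∞
        (volume.restrict (FluidPDE.parabolicCylinder r ((t₀ : ℝ), y))) =
      ‖c‖ₑ * eLpNorm (uncurry u) ∞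
        (volume.restrict (FluidPDE.parabolicCylinder (c * r) ((c ^ 2 * t₀ : ℝ), c • y - x₀))) := by
  have h1 : uncurry (fun t x => c • u (c ^ 2 * t) (c • x - x₀)) =
      c • (uncurry u ∘ FluidPDE.stAffine (c ^ 2) c 0 (-x₀)) := by
    funext ⟨s, z⟩
    simp [FluidPDE.stAffine, neg_add_eq_sub]
  rw [h1, eLpNorm_const_smul]
  congr 1
  rw [show c • y - x₀ = -x₀ + c • y from (neg_add_eq_sub x₀ (c • y)).symm,
    ← KatoLocalCovariance.stAffine_preimage_parabolicCylinder hc (-x₀) r t₀ y,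
    FluidPDE.eLpNorm_top_comp_stAffine_restrict_preimage (pow_pos hc 2) hc]

/-! ### Local-in-time Kato solutions under the Rusin–Šverák symmetries -/

/-- **Covariance of local-in-time Kato solutions.** Let `u` be a mild solution of the unforced
Navier–Stokes equations (viscosity `ν`, duality form) on `[0, T)` with datum `u₀`, in Kato's
class `C([0,T); L³(ℝ³))`, with `u(0) = u₀` and measurable on `(0,T) × ℝ³`. Then for `λ > 0`,
`x₀ ∈ ℝ³`, the field `(t, x) ↦ λ u(λ² t, λ x - x₀)` is a mild solution on `[0, T/λ²)` with datum
`λ u₀(λ · - x₀)` (`NS.rescaleData λ (u₀ (· - x₀))`) in the same class: the duality identity is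
invariant under translations (`Fluid.IsMildNSSolutionBetween.comp_sub_right_zero`) and
parabolic scalings (`Fluid.IsMildNSSolutionBetween.nsRescale_zero`), `L³(ℝ³)` is scale
invariant (`NS.continuousInLpOn_three_rescale`), measurability is transported by
`Fluid.aestronglyMeasurable_comp_stAffine_Ioo`. Rusin–Šverák 2011, §1 p. 3 and proof of
Cor. 4.3 p. 8 (the rescaled, translated data have the rescaled, translated solutions).
[cite: RusinSverak2011, §1 (arXiv:0911.0500 p. 3) and proof of Cor. 4.3 (p. 8)] -/
theorem kato_local_rescale_translate {ν T : ℝ}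
    {u₀ : EuclideanSpace ℝ (Fin 3) → EuclideanSpace ℝ (Fin 3)}
    {u : ℝ → EuclideanSpace ℝ (Fin 3) → EuclideanSpace ℝ (Fin 3)}
    (hmild : FluidPDE.IsMildNSSolutionOn (Ico 0 T) ν 0 u₀ u) (hcont : FluidPDE.ContinuousInLpOn (Ico 0 T) 3 u)
    (h0 : u 0 = u₀)
    (hmeas : AEStronglyMeasurable (uncurry u) (volume.restrict (Ioo 0 T ×ˢ univ)))
    {c : ℝ} (hc : 0 < c) (x₀ : EuclideanSpace ℝ (Fin 3)) :
    FluidPDE.IsMildNSSolutionOn (Ico 0 (T / c ^ 2)) ν 0 (FluidPDE.rescaleData c fun x => u₀ (x - x₀))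
        (fun t x => c • u (c ^ 2 * t) (c • x - x₀)) ∧
      FluidPDE.ContinuousInLpOn (Ico 0 (T / c ^ 2)) 3 (fun t x => c • u (c ^ 2 * t) (c • x - x₀)) ∧
      (fun t x => c • u (c ^ 2 * t) (c • x - x₀)) 0 = FluidPDE.rescaleData c (fun x => u₀ (x - x₀)) ∧
      AEStronglyMeasurable (uncurry fun t x => c • u (c ^ 2 * t) (c • x - x₀))
        (volume.restrict (Ioo 0 (T / c ^ 2) ×ˢ univ)) := by
  set w : ℝ → EuclideanSpace ℝ (Fin 3) → EuclideanSpace ℝ (Fin 3) := fun t x => u t (x - x₀) with hw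
  have hv : (fun t x => c • u (c ^ 2 * t) (c • x - x₀)) = FluidPDE.rescale c w := rfl
  have hc2 : 0 < c ^ 2 := pow_pos hc 2
  have hS : MapsTo (fun t => c ^ 2 * t) (Ico 0 (T / c ^ 2)) (Ico 0 T) := fun t ht => by
    refine ⟨mul_nonneg hc2.le ht.1, ?_⟩
    have := ht.2
    rw [lt_div_iff₀ hc2] at this
    linarith [mul_comm t (c ^ 2)]
  rw [hv]
  refine ⟨⟨fun t ht => ?_, fun t ht => ?_⟩, ?_, ?_, ?_⟩
  · exact ((hmild.1 (c ^ 2 * t) (hS ht)).comp_sub_right x₀).nsRescaleData hc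
  · have h2 : FluidPDE.IsMildNSSolutionBetween ν 0 u 0 (c ^ 2 * t) := by
      rw [← FluidPDE.isMildNSSolutionFrom_self_iff, h0]
      exact hmild.2 (c ^ 2 * t) (hS ht)
    have h3 : FluidPDE.IsMildNSSolutionBetween ν 0 w (c ^ 2 * 0) (c ^ 2 * t) := by
      rw [mul_zero]
      exact h2.comp_sub_right_zero x₀
    have h4 := FluidPDE.isMildNSSolutionFrom_self_iff.2
      (IsMildNSSolutionBetween.nsRescale_zero hc h3)
    have h5 : FluidPDE.nsRescale c w 0 = FluidPDE.rescaleData c fun x => u₀ (x - x₀) := by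
      funext x
      simp [FluidPDE.nsRescale, FluidPDE.rescaleData, hw, h0]
    rw [h5] at h4
    exact h4
  · exact continuousInLpOn_three_rescale (hcont.comp_sub_right x₀) hc hS
  · funext x
    simp [FluidPDE.rescale, FluidPDE.rescaleData, hw, h0]
  · have h1 : uncurry (FluidPDE.rescale c w) =
        fun z => c • (uncurry u ∘ FluidPDE.stAffine (c ^ 2) c 0 (-x₀)) z := by
      funext ⟨s, y⟩
      simp [FluidPDE.rescale, hw, FluidPDE.stAffine, neg_add_eq_sub]
    rw [h1]
    exact (FluidPDE.aestronglyMeasurable_comp_stAffine_Ioo hc2 hc (-x₀) hmeas).const_smul c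

/-- **Rusin–Šverák's normalisation of a singular Kato solution** (proof of Cor. 4.3, p. 8:
"Find `λ_k > 0` and `x₀^k` so that the functions `v^k(x) = λ_k u₀^k(λ_k x - x₀^k)` develop their
first singularity at time `t = 1` and that `(x,t) = (0,1)` is a singular point"). If `u` is a
Kato-class mild solution on `[0, T)` (`T > 0`) with datum `u₀` which is essentially unbounded
on every backward parabolic cylinder `Q_r(T, x_*)`, then with `λ = √T` and `x₀ = -x_*` the field
`v(t, x) = λ u(λ² t, λ x - x₀)` is a Kato-class mild solution on `[0, 1)` with datum
`λ u₀(λ · - x₀)`, essentially unbounded on every backward parabolic cylinder `Q_r(1, 0)`.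
[cite: RusinSverak2011, proof of Cor. 4.3 (arXiv:0911.0500 p. 8)] -/
theorem kato_local_normalise {ν T : ℝ} (hT : 0 < T)
    {u₀ : EuclideanSpace ℝ (Fin 3) → EuclideanSpace ℝ (Fin 3)}
    {u : ℝ → EuclideanSpace ℝ (Fin 3) → EuclideanSpace ℝ (Fin 3)}
    (hmild : FluidPDE.IsMildNSSolutionOn (Ico 0 T) ν 0 u₀ u) (hcont : FluidPDE.ContinuousInLpOn (Ico 0 T) 3 u)
    (h0 : u 0 = u₀)
    (hmeas : AEStronglyMeasurable (uncurry u) (volume.restrict (Ioo 0 T ×ˢ univ)))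
    (xs : EuclideanSpace ℝ (Fin 3))
    (hsing : ∀ r, 0 < r →
      eLpNorm (uncurry u) ∞ (volume.restrict (FluidPDE.parabolicCylinder r ((T : ℝ), xs))) = ∞) :
    FluidPDE.IsMildNSSolutionOn (Ico 0 1) ν 0 (FluidPDE.rescaleData (Real.sqrt T) fun x => u₀ (x - -xs))
        (fun t x => Real.sqrt T • u (Real.sqrt T ^ 2 * t) (Real.sqrt T • x - -xs)) ∧
      FluidPDE.ContinuousInLpOn (Ico 0 1) 3
        (fun t x => Real.sqrt T • u (Real.sqrt T ^ 2 * t) (Real.sqrt T • x - -xs)) ∧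
      (fun t x => Real.sqrt T • u (Real.sqrt T ^ 2 * t) (Real.sqrt T • x - -xs)) 0 =
        FluidPDE.rescaleData (Real.sqrt T) (fun x => u₀ (x - -xs)) ∧
      AEStronglyMeasurable
        (uncurry fun t x => Real.sqrt T • u (Real.sqrt T ^ 2 * t) (Real.sqrt T • x - -xs))
        (volume.restrict (Ioo 0 1 ×ˢ univ)) ∧
      ∀ r, 0 < r → eLpNorm
        (uncurry fun t x => Real.sqrt T • u (Real.sqrt T ^ 2 * t) (Real.sqrt T • x - -xs)) ∞
          (volume.restrict (FluidPDE.parabolicCylinder r ((1 : ℝ), (0 : EuclideanSpace ℝ (Fin 3))))) = ∞ := by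
  have hc : 0 < Real.sqrt T := Real.sqrt_pos.2 hT
  have hc2 : Real.sqrt T ^ 2 = T := Real.sq_sqrt hT.le
  have hT1 : T / Real.sqrt T ^ 2 = 1 := by rw [hc2, div_self hT.ne']
  obtain ⟨h1, h2, h3, h4⟩ := kato_local_rescale_translate hmild hcont h0 hmeas hc (-xs)
  rw [hT1] at h1 h2 h4
  refine ⟨h1, h2, h3, h4, fun r hr => ?_⟩
  rw [eLpNorm_top_uncurry_rescale_translate u hc (-xs) r 1 0, smul_zero, zero_sub, neg_neg,
    mul_one, hc2, hsing _ (mul_pos hc hr), ENNReal.mul_top]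
  simpa using hc.ne'

end NS

end Literature.Analysis.FluidPDE
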